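import Summits.ValiantsHypothesis.ValiantsHypothesis.Theorems.LacunarySymmetroidMatrixDescartesDoorA26WallBubblingBubblingAssembly

/-!
# Wall bubbling for `DoorA26` — the WEYL FRAME DICTIONARY: away from the merged letter the confluent frame Gram is a diagonally rescaled polar Gram

HONEST FRAMING.  Helper lemmas for the line `Cruxes/DoorA26/Lines/wall_bubbling.lean` (crux stmt-ValiantsHypothesis-19979 `DoorA26`; OPEN, typed,
never asserted), W2 seat val-sym-door-p1 g16; obligation (W), residual `NoTightChain26NC`.  Def-free; nothing here bears on `DoorA26`, `MatrixDescartes`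
(stmt-ValiantsHypothesis-18050) or `VP ≠ VNP`; registers unchanged.

THE POINT.  W2 #22/#26 (`confluentClusters`, `tightChain`) package every cluster of a sequence of twenties near a generic Weyl face (positions `0, 5`
coalescing) through the CONFLUENT FRAME at centre `s`: letter `0 ↦ e^{δ₀s}U₀ + e^{δ₅s}U₅` (merged), letter `5 ↦ (δ₅ − δ₀)·e^{δ₅s}U₅` (T-direction), letter
`a ↦ e^{δ_a s}U_a` otherwise, with `polar(frame a, frame b)/μ_c → Γ_c a b`.  For `a, b ≠ 0` the frame polar is EXACTLY `f_a f_b · e^{(δ_a+δ_b)s} · polar(U_a,U_b)`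
with `f₅ = δ₅ − δ₀`, `f_a = 1` else (`frame_polar_off_merged`) — a diagonal rescaling of the raw Gram, the SAME at every centre.  Hence the matrix
`G′_ab = f_a f_b polar(U_a,U_b)` (row/column `0` set to `0`) is realisable (`realisable_frameGram`, so every `4 × 4` minor vanishes, W1 #21) and satisfies the
two-slope package hypotheses of W2 #34 `twoSlope_dictionary` / #35 `false_of_hinge_strictly_between_of_packages` / #37–#38 verbatim with `Γ′_c = Γ_c` off the
merged letter and `0` on it (`frame_package_off_merged`): the linking and signed kills apply at Weyl faces to every minor AVOIDING THE MERGED LETTER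
(transvection-free), exactly as used in the located Weyl census (hub re-run R3: 7 394/10 830, middle survivors 446).

[folklore] bilinearity of `polar`; [this work] the dictionary.
-/

-- `Summit.ValiantsHypothesis.ValiantsHypothesis.…` repeats a component by the D-0017 layout
-- (single-conjunct summit), which the `dupNamespace` linter flags; the name is mandated.
set_option linter.dupNamespace false

namespace Summit.ValiantsHypothesis.ValiantsHypothesis.Theorems.LacunarySymmetroidMatrixDescartes.WallBubbling

open Finset Filter Topology
open Bubbling (polar polar_apply polar_smul_left_right Realisable)

/-- **Frame polar off the merged letter.**  For frame letters `a, b ≠ 0` of the confluent frame at centre `s` (W2 #22's convention: `0` merged, `5` the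
T-direction `(δ₅ − δ₀)·e^{δ₅ s}U₅`, others plain), the polar is the diagonally rescaled raw polar:
`f_a · f_b · e^{(δ_a + δ_b)s} · polar(U_a, U_b)`, `f₅ = δ₅ − δ₀`, `f_a = 1` otherwise. [this work] -/
theorem frame_polar_off_merged (δ : Fin 6 → ℝ) (U : Fin 6 → Matrix (Fin 2) (Fin 2) ℝ) (s : ℝ) (a b : Fin 6) (ha : a ≠ 0) (hb : b ≠ 0) :
    polar
      (if a = 0 then Real.exp (δ 0 * s) • U 0 + Real.exp (δ 5 * s) • U 5
        else if a = 5 then (δ 5 - δ 0) • (Real.exp (δ 5 * s) • U 5)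
        else Real.exp (δ a * s) • U a)
      (if b = 0 then Real.exp (δ 0 * s) • U 0 + Real.exp (δ 5 * s) • U 5
        else if b = 5 then (δ 5 - δ 0) • (Real.exp (δ 5 * s) • U 5)
        else Real.exp (δ b * s) • U b)
    = (if a = 5 then δ 5 - δ 0 else 1) * (if b = 5 then δ 5 - δ 0 else 1) * Real.exp ((δ a + δ b) * s) * polar (U a) (U b) := by
  rw [if_neg ha, if_neg hb]
  have hexp : Real.exp ((δ a + δ b) * s) = Real.exp (δ a * s) * Real.exp (δ b * s) := by
    rw [← Real.exp_add]; congr 1; ring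
  by_cases ha5 : a = 5 <;> by_cases hb5 : b = 5
  · subst ha5; subst hb5
    simp only [if_true, smul_smul, polar_smul_left_right, hexp]
    ring
  · subst ha5
    simp only [if_true, if_neg hb5, smul_smul, polar_smul_left_right, hexp]
    ring
  · subst hb5
    simp only [if_true, if_neg ha5, smul_smul, polar_smul_left_right, hexp]
    ring
  · simp only [if_neg ha5, if_neg hb5, polar_smul_left_right, hexp]
    ring

/-- **The rescaled raw Gram off the merged letter is realisable** (letters `f_a • U_a`, the merged letter replaced by `0`), hence all its `4 × 4` minors vanish
(W1 #21 `realisable_det_submatrix`). [this work] -/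
theorem realisable_frameGram (δ : Fin 6 → ℝ) (U : Fin 6 → Matrix (Fin 2) (Fin 2) ℝ) (hU : ∀ l, (U l).IsSymm) :
    Realisable (Matrix.of fun a b : Fin 6 =>
      if a = 0 ∨ b = 0 then 0
      else (if a = 5 then δ 5 - δ 0 else 1) * (if b = 5 then δ 5 - δ 0 else 1) * polar (U a) (U b)) := by
  refine ⟨1, fun a => if a = 0 then 0 else (if a = 5 then δ 5 - δ 0 else (1 : ℝ)) • U a, Or.inl rfl, ?_, ?_⟩
  · intro l
    by_cases hl : l = 0
    · simp only [hl, if_true]; exact Matrix.isSymm_zero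
    · simp only [if_neg hl]; exact (hU l).smul _
  · intro a b
    simp only [Matrix.of_apply, one_mul]
    by_cases ha : a = 0
    · simp [ha, polar_apply]
    · by_cases hb : b = 0
      · simp [hb, polar_apply]
      · rw [if_neg (not_or.mpr ⟨ha, hb⟩), if_neg ha, if_neg hb, polar_smul_left_right]

/-- **Frame package ⇒ two-slope package, off the merged letter.**  If at centre `s^ν` with normaliser `μ^ν` the frame polar of letters `a, b ≠ 0` converges
after division by `μ^ν` to `Γ a b` (W2 #22/#26's package), then the rescaled raw Gram entry satisfies the hypothesis shape of W2 #34's `twoSlope_dictionary`: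
`G′^ν_ab · e^{(δ^ν_a + δ^ν_b) s^ν} / μ^ν → Γ a b` with `G′^ν_ab = f^ν_a f^ν_b polar(U^ν_a, U^ν_b)`. [this work] -/
theorem frame_package_off_merged (δ : ℕ → Fin 6 → ℝ) (U : ℕ → Fin 6 → Matrix (Fin 2) (Fin 2) ℝ) (s μ : ℕ → ℝ)
    (Γ : Fin 6 → Fin 6 → ℝ) (a b : Fin 6) (ha : a ≠ 0) (hb : b ≠ 0)
    (hpkg : Tendsto (fun ν => polar
      (if a = 0 then Real.exp (δ ν 0 * s ν) • U ν 0 + Real.exp (δ ν 5 * s ν) • U ν 5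
        else if a = 5 then (δ ν 5 - δ ν 0) • (Real.exp (δ ν 5 * s ν) • U ν 5)
        else Real.exp (δ ν a * s ν) • U ν a)
      (if b = 0 then Real.exp (δ ν 0 * s ν) • U ν 0 + Real.exp (δ ν 5 * s ν) • U ν 5
        else if b = 5 then (δ ν 5 - δ ν 0) • (Real.exp (δ ν 5 * s ν) • U ν 5)
        else Real.exp (δ ν b * s ν) • U ν b) / μ ν) atTop (𝓝 (Γ a b))) :
    Tendsto (fun ν => ((if a = 5 then δ ν 5 - δ ν 0 else 1) * (if b = 5 then δ ν 5 - δ ν 0 else 1) * polar (U ν a) (U ν b))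
      * Real.exp ((δ ν a + δ ν b) * s ν) / μ ν) atTop (𝓝 (Γ a b)) := by
  refine hpkg.congr' (Eventually.of_forall fun ν => ?_)
  rw [frame_polar_off_merged (δ ν) (U ν) (s ν) a b ha hb]
  ring

/-- The merged row of the rescaled raw Gram is zero, so its «package» is the trivial limit. [folklore] -/
theorem frame_package_merged_row (δ : ℕ → Fin 6 → ℝ) (s μ : ℕ → ℝ) (a b : Fin 6) (h : a = 0 ∨ b = 0) :
    Tendsto (fun ν => (if a = 0 ∨ b = 0 then (0 : ℝ) else 1) * Real.exp ((δ ν a + δ ν b) * s ν) / μ ν) atTop (𝓝 0) := by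
  simp only [if_pos h, zero_mul, zero_div]
  exact tendsto_const_nhds

end Summit.ValiantsHypothesis.ValiantsHypothesis.Theorems.LacunarySymmetroidMatrixDescartes.WallBubbling
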